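import Mathlib
import Summits.Ventures.HodgeRepro.Tier4.Common.RowPlane
import Summits.Ventures.HodgeRepro.Tier4.Common.RowTorus
import Summits.Ventures.HodgeRepro.Tier4.Common.RowWeights
import Summits.Ventures.HodgeRepro.Tier4.Common.MixedPlaneKType

/-!
# Tier4/Common/LocalCoordinates — the `w`-component of an element of the adelic unitary group of a row plane at a
real CM place as a `2 × 2` COMPLEX matrix: the local model `U(W)(k_w) → GL₂(ℂ)` (multiplicative, continuous);
the unitary relation is the companion module `Common/LocalUnitary.lean`

Blind re-derivation cell `pub-hodge-repro`, Tier 4 «prove the step» (README §9–§10), seat t4-typer-2 (gen 4), on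
t4-L1-p5 g4's TAKE (S14786) of the offer S14784 (C-COMMON-LOCALU11).  Target tree path
`lean/Summits/Ventures/HodgeRepro/Tier4/Common/LocalCoordinates.lean`.  Imports: Mathlib + `Common.RowPlane`
(`omegaMatR`, `lineGramRowR`, `commute_omegaMatR_iff`), `Common.RowTorus` (`re4R`, `blockDiag4R`, `blockOf`,
`adMat_blockDiag4`), `Common.RowWeights` (`adToC`, `blockWeight`, `blockWeight_mul`, `wroot_sq`, `conj_wroot`,
`wroot_mul_conj`, `continuous_entryAt`), `Common.MixedPlaneKType` (`entryAt`, `lineBase`, `lineOmega`, `weightAt`).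

WHY (t4-L1-p5 g4, bus S14780 (2)(i): «NO model of `U(W)(k_{w₀}) ≅ U(1,1)` in coordinates … the `U(1,1)` relations are a
4-line consequence of `g ∈ unitaryGroup W` at `w₀` — NOT in the tree»; C-L4-D3COEFF defines the weight-3 coefficient
`D3coeff q w₀ g := (locEntry q w₀ g 0 0)⁻¹ ^ 3` on these names).  THE MODEL.  On the row plane `W = ofLinesRow q a b ε`
(basis `a₀, ω a₀, a₂, ω a₂`, row convention `v ↦ v g`) every `g ∈ G(𝔸)` commutes with `Ω = blockDiag(ω, ω)`, so its
adelic `4 × 4` matrix is a `2 × 2` matrix of `2 × 2` blocks `x + y ω` (`blockOf t n x y`, `commute_omegaMatR_iff`);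
reading each block at the real place `w` through `φ_w : 𝔸_k → ℂ` and `ω ↦ ω_w` (`blockWeight`) gives
  `locMat q w g = [[α, β], [γ, δ]] ∈ M₂(ℂ)`,  `locEntry q w g I J = entryAt (lineBase I) (lineBase J) +
  entryAt (lineOmega I) (lineBase J) · ω_w`
(the diagonal is `weightAt q w I g` on the torus).  `locMat` is multiplicative (`blockOf_mul` + the root identity
`ω_w² = t_w ω_w − n_w`), `locMat 1 = 1`, continuous; and the unitarity `g B gᵀ = B` with `B = blockDiag(a G, ε b G)`
(`G = lineGramRow`, the trace form of `h(z, z′) = z z̄′`) reads, block by block, through the identity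
`(x + y ω) G (x′ + y′ ω)ᵀ = (z z̄′) G` (`z z̄′ = (x x′ + n y y′ + t x y′) + (y x′ − x y′) ω`), as
  `locMat g * J * (locMat g)ᴴ = J`,  `J = diag(a_w, ε_w b_w)`
— the honest statement of `g_w ∈ U(B_w)`; for the seesaw plane's `mixedRow q a₀ a₂` at a place with
`a₀,w > 0 > −a₂,w` this is `U(1,1)`, and `a_w |α|² + ε_w b_w |β|² = a_w` gives `|α| ≥ 1`, `α ≠ 0`.

* `blocksOf`, `eq_re4R_fromBlocks`, `blocks_comm_omega`, `blocks_eq_blockOf`, `blocksOf_mul` — the block decomposition of `mat g`;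
* `locEntry`, `locMat`, `locEntry_eq_blockWeight`, `locEntry_diag_eq_weightAt` — the complex coordinates;
* **`locMat_mul`**, **`locMat_one`**, `continuous_locEntry`, `continuous_locMat`;
* in `Common/LocalUnitary.lean`: the unitary relation `locMat g * J * (locMat g)ᴴ = J`, `a_w ‖α‖² + ε_w b_w ‖β‖² = a_w`,
  `‖α‖ ≥ 1`, `α ≠ 0`, and the coordinates of `g⁻¹`.

Nothing here says anything about the status of the Hodge conjecture for CM abelian varieties, which is NOT proved
(HC_CM is NOT proved by anyone in this repository).
-/

set_option autoImplicit false

noncomputable section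

namespace Summit.Ventures.HodgeRepro.Tier4.Common

open NumberField Matrix Set Topology
open scoped ComplexConjugate

section Blocks

variable {k : Type} [Field k] [NumberField k] (q : QuadData k) (a b ε : k)

/-- The four `2 × 2` blocks of an adelic `4 × 4` matrix (`I J : Fin 2`), through `re4R`. -/
def blocksOf (M : M4 k) (I J : Fin 2) : Matrix (Fin 2) (Fin 2) (Ad k) :=
  fun i j => ((re4R (R := Ad k)).symm M) (if I = 0 then Sum.inl i else Sum.inr i) (if J = 0 then Sum.inl j else Sum.inr j)

/-- A matrix is `re4R` of the block matrix of its blocks. -/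
theorem eq_re4R_fromBlocks (M : M4 k) :
    M = re4R (fromBlocks (blocksOf M 0 0) (blocksOf M 0 1) (blocksOf M 1 0) (blocksOf M 1 1)) := by
  have h : fromBlocks (blocksOf M 0 0) (blocksOf M 0 1) (blocksOf M 1 0) (blocksOf M 1 1) = (re4R (R := Ad k)).symm M := by
    rw [← fromBlocks_toBlocks ((re4R (R := Ad k)).symm M)]
    rfl
  rw [h, AlgEquiv.apply_symm_apply]

/-- The `(0, 0)` entry of a block. -/
theorem blocksOf_apply_zero_zero (M : M4 k) (I J : Fin 2) :
    blocksOf M I J 0 0 = M (lineBase I) (lineBase J) := by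
  conv_rhs => rw [eq_re4R_fromBlocks M]
  fin_cases I <;> fin_cases J <;> rfl

/-- The `(1, 0)` entry of a block. -/
theorem blocksOf_apply_one_zero (M : M4 k) (I J : Fin 2) :
    blocksOf M I J 1 0 = M (lineOmega I) (lineBase J) := by
  conv_rhs => rw [eq_re4R_fromBlocks M]
  fin_cases I <;> fin_cases J <;> rfl

/-- The adelic `Ω` of a row plane is `blockDiag (ω, ω)`. -/
theorem adMat_Ω_ofLinesRow :
    adMat k (PlaneData.ofLinesRow q a b ε).Ω =
      re4R (fromBlocks (omegaMatR (algebraMap k (Ad k) q.t) (algebraMap k (Ad k) q.n)) 0 0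
        (omegaMatR (algebraMap k (Ad k) q.t) (algebraMap k (Ad k) q.n))) := by
  have h : (PlaneData.ofLinesRow q a b ε).Ω = blockDiag4 (omegaMat q) (omegaMat q) := rfl
  rw [h, adMat_blockDiag4, omegaMat_map]
  rfl

/-- **Every block of an element of `G(𝔸)` commutes with `ω`** (the unitary group commutes with `Ω`). -/
theorem blocks_comm_omega (g : GA (PlaneData.ofLinesRow q a b ε)) (I J : Fin 2) :
    blocksOf (GA.mat (PlaneData.ofLinesRow q a b ε) g) I J * omegaMatR (algebraMap k (Ad k) q.t) (algebraMap k (Ad k) q.n) =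
      omegaMatR (algebraMap k (Ad k) q.t) (algebraMap k (Ad k) q.n) * blocksOf (GA.mat (PlaneData.ofLinesRow q a b ε) g) I J := by
  set M := GA.mat (PlaneData.ofLinesRow q a b ε) g with hM
  set ω := omegaMatR (algebraMap k (Ad k) q.t) (algebraMap k (Ad k) q.n) with hω
  have hc : M * adMat k (PlaneData.ofLinesRow q a b ε).Ω = adMat k (PlaneData.ofLinesRow q a b ε).Ω * M :=
    ((mem_unitaryGroup (PlaneData.ofLinesRow q a b ε) _).1 g.2).1
  rw [adMat_Ω_ofLinesRow] at hc
  conv_lhs at hc => rw [eq_re4R_fromBlocks M]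
  conv_rhs at hc => rw [eq_re4R_fromBlocks M]
  rw [← map_mul, ← map_mul, fromBlocks_multiply, fromBlocks_multiply] at hc
  have hc' := (re4R (R := Ad k)).injective hc
  simp only [Matrix.mul_zero, Matrix.zero_mul, add_zero, zero_add] at hc'
  obtain ⟨h00, h01, h10, h11⟩ := fromBlocks_inj.1 hc'
  fin_cases I <;> fin_cases J
  · exact h00
  · exact h01
  · exact h10
  · exact h11

/-- **Every block is `x + y ω`** with `x = M (lineBase I) (lineBase J)`, `y = M (lineOmega I) (lineBase J)`. -/
theorem blocks_eq_blockOf (g : GA (PlaneData.ofLinesRow q a b ε)) (I J : Fin 2) :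
    blocksOf (GA.mat (PlaneData.ofLinesRow q a b ε) g) I J =
      blockOf (algebraMap k (Ad k) q.t) (algebraMap k (Ad k) q.n)
        (GA.mat (PlaneData.ofLinesRow q a b ε) g (lineBase I) (lineBase J))
        (GA.mat (PlaneData.ofLinesRow q a b ε) g (lineOmega I) (lineBase J)) := by
  have h := (commute_omegaMatR_iff _ _ _).1 (blocks_comm_omega q a b ε g I J)
  rw [blocksOf_apply_zero_zero, blocksOf_apply_one_zero] at h
  exact h

end Blocks

section Coordinates

variable {k : Type} [Field k] [NumberField k] (q : QuadData k) (a b ε : k) (w : InfinitePlace k)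

/-- **The complex coordinate `(I, J)` of `g` at `w`**: the block `x + y ω` of `g_w` read in `ℂ`. -/
def locEntry (g : GA (PlaneData.ofLinesRow q a b ε)) (I J : Fin 2) : ℂ :=
  entryAt (PlaneData.ofLinesRow q a b ε) w g (lineBase I) (lineBase J) +
    entryAt (PlaneData.ofLinesRow q a b ε) w g (lineOmega I) (lineBase J) * wroot q w

/-- **The local matrix** `locMat q w g = [[α, β], [γ, δ]] ∈ M₂(ℂ)`. -/
def locMat (g : GA (PlaneData.ofLinesRow q a b ε)) : Matrix (Fin 2) (Fin 2) ℂ :=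
  fun I J => locEntry q a b ε w g I J

/-- `locMat` entrywise. -/
theorem locMat_apply (g : GA (PlaneData.ofLinesRow q a b ε)) (I J : Fin 2) :
    locMat q a b ε w g I J = locEntry q a b ε w g I J := rfl

/-- The coordinate is the block weight of the block. -/
theorem locEntry_eq_blockWeight (g : GA (PlaneData.ofLinesRow q a b ε)) (I J : Fin 2) :
    locEntry q a b ε w g I J =
      blockWeight q w (blocksOf (GA.mat (PlaneData.ofLinesRow q a b ε) g) I J 0 0)
        (blocksOf (GA.mat (PlaneData.ofLinesRow q a b ε) g) I J 1 0) := by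
  simp only [locEntry, blockWeight, entryAt_eq_adToC, blocksOf_apply_zero_zero, blocksOf_apply_one_zero]

/-- The diagonal coordinate is the weight on the line. -/
theorem locEntry_diag_eq_weightAt (g : GA (PlaneData.ofLinesRow q a b ε)) (j : Fin 2) :
    locEntry q a b ε w g j j = weightAt (PlaneData.ofLinesRow q a b ε) q w j g := rfl

/-- `locEntry` is continuous in `g`. -/
theorem continuous_locEntry (I J : Fin 2) :
    Continuous fun g : GA (PlaneData.ofLinesRow q a b ε) => locEntry q a b ε w g I J :=
  (continuous_entryAt _ w _ _).add ((continuous_entryAt _ w _ _).mul continuous_const)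

/-- `locMat` is continuous in `g`. -/
theorem continuous_locMat : Continuous fun g : GA (PlaneData.ofLinesRow q a b ε) => locMat q a b ε w g :=
  continuous_matrix fun I J => continuous_locEntry q a b ε w I J

/-- The block weight is additive. -/
theorem blockWeight_add (x y x' y' : Ad k) :
    blockWeight q w (x + x') (y + y') = blockWeight q w x y + blockWeight q w x' y' := by
  simp only [blockWeight, map_add]
  ring

/-- The block weight of a block matrix `x • 1 + y • ω`, as a function of the matrix. -/
def blockWeightOf (X : Matrix (Fin 2) (Fin 2) (Ad k)) : ℂ := blockWeight q w (X 0 0) (X 1 0)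

/-- `blockWeightOf` is additive. -/
theorem blockWeightOf_add (X Y : Matrix (Fin 2) (Fin 2) (Ad k)) :
    blockWeightOf q w (X + Y) = blockWeightOf q w X + blockWeightOf q w Y := by
  simp only [blockWeightOf, Matrix.add_apply]
  exact blockWeight_add q w _ _ _ _

/-- `blockWeightOf` is multiplicative on blocks commuting with `ω` (real CM place). -/
theorem blockWeightOf_mul (hw : w.IsReal) (hcm : IsCMAt q w) {X Y : Matrix (Fin 2) (Fin 2) (Ad k)}
    (hX : X * omegaMatR (algebraMap k (Ad k) q.t) (algebraMap k (Ad k) q.n) =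
      omegaMatR (algebraMap k (Ad k) q.t) (algebraMap k (Ad k) q.n) * X)
    (hY : Y * omegaMatR (algebraMap k (Ad k) q.t) (algebraMap k (Ad k) q.n) =
      omegaMatR (algebraMap k (Ad k) q.t) (algebraMap k (Ad k) q.n) * Y) :
    blockWeightOf q w (X * Y) = blockWeightOf q w X * blockWeightOf q w Y := by
  have hX' := (commute_omegaMatR_iff _ _ _).1 hX
  have hY' := (commute_omegaMatR_iff _ _ _).1 hY
  have hXb : X = blockOf (algebraMap k (Ad k) q.t) (algebraMap k (Ad k) q.n) (X 0 0) (X 1 0) := hX'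
  have hYb : Y = blockOf (algebraMap k (Ad k) q.t) (algebraMap k (Ad k) q.n) (Y 0 0) (Y 1 0) := hY'
  rw [blockWeightOf, blockWeightOf, blockWeightOf, hXb, hYb, blockOf_mul, blockOf_apply_zero_zero,
    blockOf_apply_one_zero, blockOf_apply_zero_zero, blockOf_apply_one_zero, blockOf_apply_zero_zero,
    blockOf_apply_one_zero]
  exact blockWeight_mul q w hw hcm _ _ _ _

/-- The blocks of `re4R N` are the entries of `N` on the summands. -/
theorem blocksOf_re4R (N : Matrix (Fin 2 ⊕ Fin 2) (Fin 2 ⊕ Fin 2) (Ad k)) (I J : Fin 2) :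
    blocksOf (re4R N) I J =
      fun i j => N (if I = 0 then Sum.inl i else Sum.inr i) (if J = 0 then Sum.inl j else Sum.inr j) := by
  funext i j
  simp only [blocksOf, AlgEquiv.symm_apply_apply]

/-- The four blocks of `re4R (fromBlocks A B C D)`. -/
theorem blocksOf_re4R_fromBlocks (A B C D : Matrix (Fin 2) (Fin 2) (Ad k)) :
    blocksOf (re4R (fromBlocks A B C D)) 0 0 = A ∧ blocksOf (re4R (fromBlocks A B C D)) 0 1 = B ∧
      blocksOf (re4R (fromBlocks A B C D)) 1 0 = C ∧ blocksOf (re4R (fromBlocks A B C D)) 1 1 = D := by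
  refine ⟨?_, ?_, ?_, ?_⟩ <;> rw [blocksOf_re4R] <;> funext i j <;> simp [fromBlocks]

/-- The blocks of a product are the block products. -/
theorem blocksOf_mul (M N : M4 k) (I J : Fin 2) :
    blocksOf (M * N) I J = blocksOf M I 0 * blocksOf N 0 J + blocksOf M I 1 * blocksOf N 1 J := by
  have h : M * N = re4R (fromBlocks (blocksOf M 0 0 * blocksOf N 0 0 + blocksOf M 0 1 * blocksOf N 1 0)
      (blocksOf M 0 0 * blocksOf N 0 1 + blocksOf M 0 1 * blocksOf N 1 1)
      (blocksOf M 1 0 * blocksOf N 0 0 + blocksOf M 1 1 * blocksOf N 1 0)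
      (blocksOf M 1 0 * blocksOf N 0 1 + blocksOf M 1 1 * blocksOf N 1 1)) := by
    conv_lhs => rw [eq_re4R_fromBlocks M, eq_re4R_fromBlocks N]
    rw [← map_mul, fromBlocks_multiply]
  rw [h]
  obtain ⟨h00, h01, h10, h11⟩ := blocksOf_re4R_fromBlocks (blocksOf M 0 0 * blocksOf N 0 0 + blocksOf M 0 1 * blocksOf N 1 0)
      (blocksOf M 0 0 * blocksOf N 0 1 + blocksOf M 0 1 * blocksOf N 1 1)
      (blocksOf M 1 0 * blocksOf N 0 0 + blocksOf M 1 1 * blocksOf N 1 0)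
      (blocksOf M 1 0 * blocksOf N 0 1 + blocksOf M 1 1 * blocksOf N 1 1)
  fin_cases I <;> fin_cases J
  · exact h00
  · exact h01
  · exact h10
  · exact h11

/-- **`locMat` is multiplicative** at a real CM place: the blocks of `g h` are the block products, each block is
`x + y ω`, and the block weight is multiplicative (`ω_w² = t_w ω_w − n_w`). -/
theorem locMat_mul (hw : w.IsReal) (hcm : IsCMAt q w) (g h : GA (PlaneData.ofLinesRow q a b ε)) :
    locMat q a b ε w (g * h) = locMat q a b ε w g * locMat q a b ε w h := by
  ext I J
  rw [Matrix.mul_apply, Fin.sum_univ_two, locMat_apply, locMat_apply, locMat_apply, locMat_apply, locMat_apply,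
    locEntry_eq_blockWeight, locEntry_eq_blockWeight, locEntry_eq_blockWeight, locEntry_eq_blockWeight,
    locEntry_eq_blockWeight, GA.mat_mul, blocksOf_mul]
  change blockWeightOf q w _ = blockWeightOf q w _ * blockWeightOf q w _ + blockWeightOf q w _ * blockWeightOf q w _
  rw [blockWeightOf_add, blockWeightOf_mul q w hw hcm (blocks_comm_omega q a b ε g I 0) (blocks_comm_omega q a b ε h 0 J),
    blockWeightOf_mul q w hw hcm (blocks_comm_omega q a b ε g I 1) (blocks_comm_omega q a b ε h 1 J)]

/-- **`locMat 1 = 1`**. -/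
theorem locMat_one : locMat q a b ε w (1 : GA (PlaneData.ofLinesRow q a b ε)) = 1 := by
  ext I J
  have h1 : GA.mat (PlaneData.ofLinesRow q a b ε) (1 : GA (PlaneData.ofLinesRow q a b ε)) = 1 := rfl
  fin_cases I <;> fin_cases J <;>
    simp [locMat_apply, locEntry, entryAt_eq_adToC, h1, lineBase, lineOmega, Fin.ext_iff]

end Coordinates

end Summit.Ventures.HodgeRepro.Tier4.Common

end
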